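import Summits.ResolutionOfSingularities.ResolutionOfSingularities.Theses.Valuative
import Summits.ResolutionOfSingularities.ResolutionOfSingularities.Theorems.ValuativeLuAlphaPTorsorDenseRange
import Summits.ResolutionOfSingularities.ResolutionOfSingularities.Theorems.ValuativeLuAlphaPTorsorAbhyankarSubfieldDefectless
import Summits.ResolutionOfSingularities.ResolutionOfSingularities.Theorems.ValuativeLuAlphaPTorsorDenseLinearIndepOnPow
import Summits.ResolutionOfSingularities.ResolutionOfSingularities.Theorems.ValuativeLuAlphaPTorsorSeparablyGeneratedOfLinearIndepOnPow
import Literature.AlgebraicGeometry.Resolution.ValuationDefect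

/-!
# `LuAlphaPTorsor` along valuations dense in an Abhyankar subfunction field: the separability of `K/F₀` is automatic (Knaf–Kuhlmann 2009, Lemma 3.12)

Crux `Valuative.LuAlphaPTorsor` (item `stmt-ResolutionOfSingularities-0641`), line
`pfaff-line-log-final-forms`, lead seat c6 (2026-08-17), reshape v6.7. The dense-Abhyankar range
`denseRange` (`…Theorems.ValuativeLuAlphaPTorsorDenseRange`, Knaf–Kuhlmann 2009 Thm. 1.5 in relative
form) carried the hypothesis "`K/F₀` separably generated". As in the printed theorem it is
AUTOMATIC: KK09 Lemma 3.12 ("every immediate extension of a defectless field is separable") +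
Kuhlmann's generalized stability theorem (Trans. AMS 362 (2010), Thm. 1.1, PROVED in the tree as
`Kuhlmann2010Stability_holds`) + MacLane's criterion (Mathlib). The three stubs are landed — S1a
`stub_abhyankarSubfieldDefectless` p163921, S1b `stub_denseLinearIndepOnPow` p164379, S2
`stub_separablyGeneratedOfLinearIndepOnPow` p163930 — and composed here BY NAME:

* `denseRange2` — relative local uniformization along every valuation ring `O ⊇ k` of `K/k`
  (char `p`) dense in a finitely generated subfield `F₀ ⊇ k` on which `O` is an Abhyankar place with
  separably generated residue field extension (the only remaining separability hypothesis, that of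
  Knaf–Kuhlmann 2005 Thm. 1.1; it is removed for zero-dimensional `O` in reshape v6.8);
* `denseRange2_crux` — the crux there.

Source: H. Knaf, F.-V. Kuhlmann, Adv. Math. 221 (2009) 428–453 = arXiv:math/0702856, Thm. 1.5,
Lemma 3.12.
-/

set_option linter.dupNamespace false

open IsLocalRing

namespace Summit.ResolutionOfSingularities.ResolutionOfSingularities.Theorems.PfaffLine

open Literature.AlgebraicGeometry.Resolution

/-- **Knaf–Kuhlmann 2009, Thm. 1.5 (first case) in relative form, without the separability
hypothesis on `K/F₀`** (registered anchor): `denseRange` with `K/F₀` separably generated supplied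
by S1a + S1b + S2. [cite: KnafKuhlmann2009, Thm. 1.5 and Lemma 3.12] -/
theorem denseRange2 :
    ∀ p : ℕ, p.Prime → ∀ (k K : Type) [Field k] [CharP k p] [Field K] [Algebra k K] (O : ValuationSubring K), (∀ c : k, algebraMap k K c ∈ O) → (⊤ : IntermediateField k K).FG → (∃ F₀ : Subfield K, (algebraMap k K).fieldRange ≤ F₀ ∧ Literature.AlgebraicGeometry.Resolution.FGOver (algebraMap k K).fieldRange F₀ ∧ Literature.AlgebraicGeometry.Resolution.IsAbhyankarPlace O (algebraMap k K).fieldRange F₀ ∧ Literature.AlgebraicGeometry.Resolution.SeparablyGeneratedOver (Literature.AlgebraicGeometry.Resolution.resField O (algebraMap k K).fieldRange) (Literature.AlgebraicGeometry.Resolution.resField O F₀) ∧ ∀ x w : K, w ≠ 0 → ∃ a ∈ F₀, O.valuation (x - a) < O.valuation w) → ∀ (S : Subalgebra k K), S.FG → S.toSubring ≤ O.toSubring → ∃ (A : Subalgebra k K) (h : A.toSubring ≤ O.toSubring), S ≤ A ∧ A.FG ∧ IsFractionRing A K ∧ IsRegularLocalRing (Localization.AtPrime (Ideal.comap (Subring.inclusion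 h) (IsLocalRing.maximalIdeal O))) := by
  intro p hp k K _ _ _ _ O hk htopfg hdense S hSfg hSO
  obtain ⟨F₀, hkF₀, hfgF₀, hAbh, hsepres, hd⟩ := hdense
  haveI : CharP K p := charP_of_injective_algebraMap (algebraMap k K).injective p
  -- `K/F₀` is finitely generated
  have hfgtop : FGOver F₀ (⊤ : Subfield K) := by
    obtain ⟨s, hs⟩ := htopfg
    refine ⟨s, ?_⟩
    rw [eq_top_iff]
    have h1 : (IntermediateField.adjoin k (s : Set K)).toSubfield =
        Subfield.closure (Set.range (algebraMap k K) ∪ (s : Set K)) := rfl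
    have h2 : Subfield.closure (Set.range (algebraMap k K) ∪ (s : Set K)) ≤
        Subfield.closure ((F₀ : Set K) ∪ s) :=
      Subfield.closure_mono (Set.union_subset_union_left _ fun x hx => hkF₀ (by
        obtain ⟨c, rfl⟩ := hx; exact ⟨c, rfl⟩))
    intro z _
    have hz : z ∈ (IntermediateField.adjoin k (s : Set K)).toSubfield := by rw [hs]; trivial
    rw [h1] at hz
    exact h2 hz
  -- `K/F₀` is separably generated (Lemma 3.12 + stability + MacLane)
  have hdefl := stub_abhyankarSubfieldDefectless k K O hk F₀ hkF₀ hfgF₀ hAbh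
  have hH := stub_denseLinearIndepOnPow p hp K O F₀ hdefl hd
  have hsepgen := stub_separablyGeneratedOfLinearIndepOnPow p hp K F₀ hfgtop hH
  exact denseRange k K O hk htopfg ⟨F₀, hkF₀, hfgF₀, hAbh, hsepres, hsepgen, hd⟩ S hSfg hSO

/-- **The crux along the dense-Abhyankar range, without the separability hypothesis on `K/F₀`.**
[cite: KnafKuhlmann2009, Thm. 1.5] -/
theorem denseRange2_crux :
    ∀ p : ℕ, p.Prime → ∀ (k K : Type) [Field k] [CharP k p] [Field K] [Algebra k K] (O : ValuationSubring K) (A₀ : Subalgebra k K) (h₀ : A₀.toSubring ≤ O.toSubring) (t : K), A₀.FG → t ^ p ∈ A₀ → IsFractionRing (Algebra.adjoin k (insert t (A₀ : Set K))) K → (∃ F₀ : Subfield K, (algebraMap k K).fieldRange ≤ F₀ ∧ Literature.AlgebraicGeometry.Resolution.FGOver (algebraMap k K).fieldRange F₀ ∧ Literature.AlgebraicGeometry.Resolution.IsAbhyankarPlace O (algebraMap k K).fieldRange F₀ ∧ Literature.AlgebraicGeometry.Resolution.SeparablyGeneratedOver (Literature.AlgebraicGeometry.Resolution.resField O (algebraMap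 k K).fieldRange) (Literature.AlgebraicGeometry.Resolution.resField O F₀) ∧ ∀ x w : K, w ≠ 0 → ∃ a ∈ F₀, O.valuation (x - a) < O.valuation w) → ∃ (A : Subalgebra k K) (h : A.toSubring ≤ O.toSubring), A₀ ≤ A ∧ t ∈ A ∧ A.FG ∧ IsFractionRing A K ∧ IsRegularLocalRing (Localization.AtPrime (Ideal.comap (Subring.inclusion h) (IsLocalRing.maximalIdeal O))) := by
  intro p hp k K _ _ _ _ O A₀ h₀ t hfg htp hfr hdense
  classical
  have hk : ∀ c : k, algebraMap k K c ∈ O := fun c => h₀ (A₀.algebraMap_mem c)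
  have htO : t ∈ O := mem_valuationSubring_of_pow_mem O hp.ne_zero (h₀ htp)
  obtain ⟨g, hg⟩ := hfg
  have htopfg : (⊤ : IntermediateField k K).FG := by
    refine ⟨insert t g, ?_⟩
    rw [eq_top_iff]
    intro z _
    haveI := hfr
    obtain ⟨a, b, -, rfl⟩ :=
      IsFractionRing.div_surjective (A := Algebra.adjoin k (insert t (A₀ : Set K))) z
    have hle : Algebra.adjoin k (insert t (A₀ : Set K)) ≤
        (IntermediateField.adjoin k ((insert t g : Finset K) : Set K)).toSubalgebra := by
      rw [← hg, Algebra.adjoin_insert_adjoin, Finset.coe_insert]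
      exact IntermediateField.algebra_adjoin_le_adjoin k _
    exact div_mem (hle a.2) (hle b.2)
  set S : Subalgebra k K := Algebra.adjoin k (insert t (A₀ : Set K)) with hS
  have hSfg : S.FG := by
    refine ⟨insert t g, ?_⟩
    rw [hS, ← hg, Algebra.adjoin_insert_adjoin, Finset.coe_insert]
  let OA : Subalgebra k K :=
    { O.toSubring with algebraMap_mem' := fun c => hk c }
  have hSOA : S ≤ OA := by
    rw [hS]
    exact Algebra.adjoin_le (Set.insert_subset htO fun z hz => h₀ hz)
  have hSO : S.toSubring ≤ O.toSubring := fun z hz => hSOA hz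
  obtain ⟨A, hAO, hSA, hAfg, hfrA, hreg⟩ := denseRange2 p hp k K O hk htopfg hdense S hSfg hSO
  refine ⟨A, hAO, ?_, ?_, hAfg, hfrA, hreg⟩
  · intro z hz
    exact hSA (Algebra.subset_adjoin (Set.mem_insert_of_mem t hz))
  · exact hSA (Algebra.subset_adjoin (Set.mem_insert t _))

end Summit.ResolutionOfSingularities.ResolutionOfSingularities.Theorems.PfaffLine
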